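import Literature.NumberTheory.LFunctions.GranvilleSoundararajanMeanSquare
import Literature.NumberTheory.LFunctions.GranvilleSoundararajanTwistedPlancherel
import Literature.NumberTheory.LFunctions.GranvilleSoundararajanLemma21Lipschitz
import HarnessLib

/-!
# Granville–Soundararajan 2003, Proposition 3.3: the twisted mean square ((3.8) + Lemma 3.2)

Ingredient of the proof of **Theorem 4** of A. Granville, K. Soundararajan, *Decay of mean values
of multiplicative functions*, Canad. J. Math. 55 (2003): the inner integral of Proposition 3.3 (the
Lipschitz variant of Proposition 1).  For a multiplicative `1`-bounded `f` with smooth truncation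
`f̃ = smoothCut f N` (`N = ⌊x⌋`), `F(s) = ∑ f̃(n) n^{-s}`, `D(s) = ∑ f̃(n) log n · n^{-s}`,
`A(y) = ∑_{n ≤ y} f̃(n) log n`, and a real `w ≥ 1`:

* `exists_inner_integral_twisted_le` — **(3.8) + Lemma 3.2, twisted** (crude constants): if
  `|F(s)(1 - w^{1-s})| ≤ B_w` on the window `|y| ≤ T` (`s = 1+α+iy`, `0 < α ≤ 1`, `T ≥ 1`), then
  `∫_{log 2w}^{log x} |A(e^u) - wA(e^u/w)| e^{-(1+2α)u} du ≤ 6 B_w √(m/α) + C(√(m/α) + √m/√T + m²/T)`,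
  `m = min(log x, 1/α)`.  By Cauchy–Schwarz and the twisted Mellin–Plancherel identity
  (`GranvilleSoundararajanTwistedPlancherel`) this reduces to `∫_ℝ |D(s)(1-w^{1-s})|²/|s|² dy`; the
  window `|y| ≤ T` is treated by the decomposition `D = P_g F + G E_h` of the tree
  (`GranvilleSoundararajanDecomposition`, GS03 (3.12)) with `|1 - w^{1-s}| ≤ 2` on the `G E_h` part,
  and the tails `|y| > T` by the tree's `T`-block bounds (`GranvilleSoundararajanMeanSquare`, (3.11))
  and `|1 - w^{1-s}| ≤ 2`; the kernel bound on `(log 2w, log x]` is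
  `GranvilleSoundararajanLemma21Lipschitz.norm_twisted_kernel_le`.

## References
- [GranvilleSoundararajan2003] A. Granville, K. Soundararajan, *Decay of mean values of
  multiplicative functions*, Canad. J. Math. 55 (2003), 1191–1230: §3b ((3.8)–(3.14), Lemma 3.2)
  and Proposition 3.3 with its proof; arXiv math/9911246 pp. 7–8.

## Design choices
* Constants are crude and existential (Theorem 4 is a `≪` statement); the sharp `(1-x^{-2α})/(2α)`
  of the tree's Theorem 1 files is not needed: the main term here is `B_w √(m/α)`.
-/

noncomputable section

open Finset Real Complex MeasureTheory Set Filter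

namespace Literature.NumberTheory.LFunctions

namespace GranvilleSoundararajan

open Halasz (smoothCut mulLog mulVM smoothCut_of_mem smoothCut_of_not_mem norm_smoothCut_le)
open MellinPlancherel (psum phi)

variable {g : ℕ → ℂ} {N : ℕ}

/-- The twisted integrand `|D(s)|² |1 - w^{1-s}|²/|s|²` is integrable over the line (it is at most
`4 |D(s)|²/|s|²`). [folklore] -/
theorem integrable_twisted_integrand (hgb : ∀ n, ‖g n‖ ≤ 1) {α : ℝ} (hα : 0 < α) {w : ℝ} (hw : 1 ≤ w) :
    Integrable fun y : ℝ => ‖LSeries (mulLog g N) (1 + α + y * I)‖ ^ 2 *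
      ‖1 - (w : ℂ) ^ (1 - ((1 : ℂ) + α + y * I))‖ ^ 2 / ‖(1 : ℂ) + α + y * I‖ ^ 2 := by
  have hint := Halasz.integrable_normSq_mulLog_div (N := N) hgb hα
  have hcont : Continuous fun y : ℝ => ‖LSeries (mulLog g N) (1 + α + y * I)‖ ^ 2 *
      ‖1 - (w : ℂ) ^ (1 - ((1 : ℂ) + α + y * I))‖ ^ 2 / ‖(1 : ℂ) + α + y * I‖ ^ 2 := by
    refine ((Halasz.continuous_norm_LSeries_mulLog_sq hgb hα).mul
      ((continuous_twist (by linarith) α).norm.pow 2)).div ((Continuous.norm (by fun_prop)).pow 2) fun y => ?_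
    have : ((1 : ℂ) + α + y * I) ≠ 0 := by
      intro h; have := congrArg Complex.re h; simp at this; linarith
    positivity
  refine Integrable.mono' (hint.const_mul 4) hcont.aestronglyMeasurable (Filter.Eventually.of_forall fun y => ?_)
  rw [Real.norm_of_nonneg (by positivity)]
  have h2 := norm_twist_le_two hw hα.le y
  have h4 : ‖1 - (w : ℂ) ^ (1 - ((1 : ℂ) + α + y * I))‖ ^ 2 ≤ 4 := by nlinarith [norm_nonneg (1 - (w : ℂ) ^ (1 - ((1 : ℂ) + α + y * I)))]
  have hs0 : 0 < ‖(1 : ℂ) + α + y * I‖ ^ 2 := by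
    have : ((1 : ℂ) + α + y * I) ≠ 0 := by
      intro h; have := congrArg Complex.re h; simp at this; linarith
    positivity
  calc ‖LSeries (mulLog g N) (1 + α + y * I)‖ ^ 2 * ‖1 - (w : ℂ) ^ (1 - ((1 : ℂ) + α + y * I))‖ ^ 2 /
        ‖(1 : ℂ) + α + y * I‖ ^ 2
      ≤ ‖LSeries (mulLog g N) (1 + α + y * I)‖ ^ 2 * 4 / ‖(1 : ℂ) + α + y * I‖ ^ 2 := by gcongr
    _ = 4 * (‖LSeries (mulLog g N) (1 + α + y * I)‖ ^ 2 / ‖(1 : ℂ) + α + y * I‖ ^ 2) := by ring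

/-- Pointwise: twisted integrand `≤ 4 ×` untwisted integrand. [folklore] -/
theorem twisted_integrand_le (g : ℕ → ℂ) (N : ℕ) {α : ℝ} (hα : 0 ≤ α) {w : ℝ} (hw : 1 ≤ w) (y : ℝ) :
    ‖LSeries (mulLog g N) (1 + α + y * I)‖ ^ 2 * ‖1 - (w : ℂ) ^ (1 - ((1 : ℂ) + α + y * I))‖ ^ 2 /
        ‖(1 : ℂ) + α + y * I‖ ^ 2 ≤
      4 * (‖LSeries (mulLog g N) (1 + α + y * I)‖ ^ 2 / ‖(1 : ℂ) + α + y * I‖ ^ 2) := by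
  have h2 := norm_twist_le_two hw hα y
  have h4 : ‖1 - (w : ℂ) ^ (1 - ((1 : ℂ) + α + y * I))‖ ^ 2 ≤ 4 := by
    nlinarith [norm_nonneg (1 - (w : ℂ) ^ (1 - ((1 : ℂ) + α + y * I)))]
  have hs0 : 0 < ‖(1 : ℂ) + α + y * I‖ ^ 2 := by
    have : ((1 : ℂ) + α + y * I) ≠ 0 := by
      intro h; have := congrArg Complex.re h; simp at this; linarith
    positivity
  calc ‖LSeries (mulLog g N) (1 + α + y * I)‖ ^ 2 * ‖1 - (w : ℂ) ^ (1 - ((1 : ℂ) + α + y * I))‖ ^ 2 /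
        ‖(1 : ℂ) + α + y * I‖ ^ 2
      ≤ ‖LSeries (mulLog g N) (1 + α + y * I)‖ ^ 2 * 4 / ‖(1 : ℂ) + α + y * I‖ ^ 2 := by gcongr
    _ = 4 * (‖LSeries (mulLog g N) (1 + α + y * I)‖ ^ 2 / ‖(1 : ℂ) + α + y * I‖ ^ 2) := by ring

/-- **The tails of the twisted integral**: `∫_{|y| > T} |D(1-w^{1-s})|²/|s|² ≤ 4 · (2 · 2Q/T²)`.
[cite: GranvilleSoundararajan2003, (3.11) and proof of Proposition 3.3] -/
theorem twisted_tails_le (hgb : ∀ n, ‖g n‖ ≤ 1) {α : ℝ} (hα : 0 < α) {T : ℝ} (hT : 0 < T) {w : ℝ} (hw : 1 ≤ w)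
    {R₀ R₁ : ℝ} (hR₀ : ∑' n : ℕ, ‖LSeries.term (mulLog g N) (1 + α) n‖ ^ 2 ≤ R₀)
    (hs₁ : Summable fun n : ℕ => (n : ℝ) * ‖LSeries.term (mulLog g N) (1 + α) n‖ ^ 2)
    (hR₁ : ∑' n : ℕ, (n : ℝ) * ‖LSeries.term (mulLog g N) (1 + α) n‖ ^ 2 ≤ R₁) :
    (∫ y in Set.Iio (-T), ‖LSeries (mulLog g N) (1 + α + y * I)‖ ^ 2 *
        ‖1 - (w : ℂ) ^ (1 - ((1 : ℂ) + α + y * I))‖ ^ 2 / ‖(1 : ℂ) + α + y * I‖ ^ 2) +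
      (∫ y in Set.Ioi T, ‖LSeries (mulLog g N) (1 + α + y * I)‖ ^ 2 *
        ‖1 - (w : ℂ) ^ (1 - ((1 : ℂ) + α + y * I))‖ ^ 2 / ‖(1 : ℂ) + α + y * I‖ ^ 2) ≤
      16 * ((5 * (T / 2) + 20) * R₀ + 65 * R₁) / T ^ 2 := by
  have htR := setIntegral_Ioi_tail_le_T (N := N) hgb hα hT hR₀ hs₁ hR₁
  have htL := setIntegral_Iio_tail_le_T (N := N) hgb hα hT hR₀ hs₁ hR₁
  have hint := Halasz.integrable_normSq_mulLog_div (N := N) hgb hα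
  have hintw := integrable_twisted_integrand (N := N) hgb hα hw
  have hL : ∫ y in Set.Iio (-T), ‖LSeries (mulLog g N) (1 + α + y * I)‖ ^ 2 *
        ‖1 - (w : ℂ) ^ (1 - ((1 : ℂ) + α + y * I))‖ ^ 2 / ‖(1 : ℂ) + α + y * I‖ ^ 2 ≤
      4 * ∫ y in Set.Iio (-T), ‖LSeries (mulLog g N) (1 + α + y * I)‖ ^ 2 / ‖(1 : ℂ) + α + y * I‖ ^ 2 := by
    rw [← integral_const_mul]
    exact setIntegral_mono_on hintw.integrableOn (hint.const_mul 4).integrableOn measurableSet_Iio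
      fun y _ => twisted_integrand_le g N hα.le hw y
  have hR : ∫ y in Set.Ioi T, ‖LSeries (mulLog g N) (1 + α + y * I)‖ ^ 2 *
        ‖1 - (w : ℂ) ^ (1 - ((1 : ℂ) + α + y * I))‖ ^ 2 / ‖(1 : ℂ) + α + y * I‖ ^ 2 ≤
      4 * ∫ y in Set.Ioi T, ‖LSeries (mulLog g N) (1 + α + y * I)‖ ^ 2 / ‖(1 : ℂ) + α + y * I‖ ^ 2 := by
    rw [← integral_const_mul]
    exact setIntegral_mono_on hintw.integrableOn (hint.const_mul 4).integrableOn measurableSet_Ioi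
      fun y _ => twisted_integrand_le g N hα.le hw y
  have h4 : (0:ℝ) ≤ 4 := by norm_num
  calc _ ≤ 4 * (2 * ((5 * (T / 2) + 20) * R₀ + 65 * R₁) / T ^ 2) + 4 * (2 * ((5 * (T / 2) + 20) * R₀ + 65 * R₁) / T ^ 2) :=
        add_le_add (hL.trans (mul_le_mul_of_nonneg_left htL h4)) (hR.trans (mul_le_mul_of_nonneg_left htR h4))
    _ = 16 * ((5 * (T / 2) + 20) * R₀ + 65 * R₁) / T ^ 2 := by ring

/-- Splitting `∫_ℝ = ∫_{[-T,T]} + ∫_{(-∞,-T)} + ∫_{(T,∞)}` for the twisted integrand. [folklore] -/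
theorem twisted_integral_le_window_add_tails (hgb : ∀ n, ‖g n‖ ≤ 1) {α : ℝ} (hα : 0 < α) {T : ℝ}
    (hT : 0 ≤ T) {w : ℝ} (hw : 1 ≤ w) :
    ∫ y : ℝ, ‖LSeries (mulLog g N) (1 + α + y * I)‖ ^ 2 *
        ‖1 - (w : ℂ) ^ (1 - ((1 : ℂ) + α + y * I))‖ ^ 2 / ‖(1 : ℂ) + α + y * I‖ ^ 2 ≤
      (∫ y in Set.Icc (-T) T, ‖LSeries (mulLog g N) (1 + α + y * I)‖ ^ 2 *
        ‖1 - (w : ℂ) ^ (1 - ((1 : ℂ) + α + y * I))‖ ^ 2 / ‖(1 : ℂ) + α + y * I‖ ^ 2) +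
      ((∫ y in Set.Iio (-T), ‖LSeries (mulLog g N) (1 + α + y * I)‖ ^ 2 *
        ‖1 - (w : ℂ) ^ (1 - ((1 : ℂ) + α + y * I))‖ ^ 2 / ‖(1 : ℂ) + α + y * I‖ ^ 2) +
      (∫ y in Set.Ioi T, ‖LSeries (mulLog g N) (1 + α + y * I)‖ ^ 2 *
        ‖1 - (w : ℂ) ^ (1 - ((1 : ℂ) + α + y * I))‖ ^ 2 / ‖(1 : ℂ) + α + y * I‖ ^ 2)) := by
  have hint := integrable_twisted_integrand (N := N) hgb hα hw
  rw [← integral_add_compl (measurableSet_Icc (a := -T) (b := T)) hint]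
  gcongr
  have hsub : (Set.Icc (-T) T)ᶜ ⊆ Set.Iio (-T) ∪ Set.Ioi T := by
    intro y hy
    simp only [Set.mem_compl_iff, Set.mem_Icc, not_and_or, not_le] at hy
    rcases hy with h | h
    · exact Or.inl h
    · exact Or.inr h
  calc ∫ y in (Set.Icc (-T) T)ᶜ, ‖LSeries (mulLog g N) (1 + α + y * I)‖ ^ 2 *
        ‖1 - (w : ℂ) ^ (1 - ((1 : ℂ) + α + y * I))‖ ^ 2 / ‖(1 : ℂ) + α + y * I‖ ^ 2
      ≤ ∫ y in Set.Iio (-T) ∪ Set.Ioi T, ‖LSeries (mulLog g N) (1 + α + y * I)‖ ^ 2 *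
        ‖1 - (w : ℂ) ^ (1 - ((1 : ℂ) + α + y * I))‖ ^ 2 / ‖(1 : ℂ) + α + y * I‖ ^ 2 :=
        setIntegral_mono_set hint.integrableOn
          (Filter.Eventually.of_forall fun y => by positivity) hsub.eventuallyLE
    _ = _ := by
        refine setIntegral_union ?_ measurableSet_Ioi hint.integrableOn hint.integrableOn
        exact Set.disjoint_left.2 fun y hy hy' => by
          simp only [Set.mem_Iio] at hy; simp only [Set.mem_Ioi] at hy'
          linarith

/-- **The window, twisted** (GS03 (3.12)–(3.13) in the proof of Proposition 3.3): for `1`-bounded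
multiplicative `f`, `g = cmLift f`, `w ≥ 1`, and `|F(s)(1 - w^{1-s})| ≤ B_w` on `|y| ≤ T` (`s = 1+α+iy`),
`∫_{|y|≤T} |D_f (1-w^{1-s})|²/|s|² ≤ 2 B_w² ∫_ℝ |P_g|²/|s|² + 8 (3 cmDefectBound)² ∫_ℝ |G|²/|s|²`.
[cite: GranvilleSoundararajan2003, (3.12)–(3.13) and proof of Proposition 3.3] -/
theorem setIntegral_window_twisted_le (f : ArithmeticFunction ℂ) (hf : f.IsMultiplicative)
    (hfb : ∀ n, ‖f n‖ ≤ 1) (N : ℕ) {α : ℝ} (hα : 0 < α) {T Bw w : ℝ} (hw : 1 ≤ w)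
    (hB : ∀ y : ℝ, |y| ≤ T → ‖LSeries (smoothCut (⇑f) N) (1 + α + y * I) *
      (1 - (w : ℂ) ^ (1 - ((1 : ℂ) + α + y * I)))‖ ≤ Bw) :
    ∫ y in Set.Icc (-T) T, ‖LSeries (mulLog (⇑f) N) (1 + α + y * I)‖ ^ 2 *
        ‖1 - (w : ℂ) ^ (1 - ((1 : ℂ) + α + y * I))‖ ^ 2 / ‖(1 : ℂ) + α + y * I‖ ^ 2 ≤
      2 * Bw ^ 2 * (∫ y : ℝ, ‖LSeries (mulVM (⇑(cmLift f)) N) (1 + α + y * I)‖ ^ 2 /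
          ‖(1 : ℂ) + α + y * I‖ ^ 2) +
        8 * (3 * cmDefectBound) ^ 2 *
          (∫ y : ℝ, ‖LSeries (smoothCut (⇑(cmLift f)) N) (1 + α + y * I)‖ ^ 2 / ‖(1 : ℂ) + α + y * I‖ ^ 2) := by
  have hgb : ∀ n, ‖cmLift f n‖ ≤ 1 := norm_cmLift_le_one f (fun p _ => hfb p)
  have hintD := integrable_twisted_integrand (g := ⇑f) (N := N) hfb hα hw
  have hintP : Integrable (fun y : ℝ => ‖LSeries (mulVM (⇑(cmLift f)) N) (1 + α + y * I)‖ ^ 2 /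
      ‖(1 : ℂ) + α + y * I‖ ^ 2) := by
    have h := Halasz.integrable_norm_LSeries_sq_div (a := mulVM (⇑(cmLift f)) N) (σ := 1 + α) (by linarith)
      (Halasz.summable_norm_mulVM_div_rpow hgb (by linarith))
    simpa only [Halasz.ofReal_one_add] using h
  have hintG : Integrable (fun y : ℝ => ‖LSeries (smoothCut (⇑(cmLift f)) N) (1 + α + y * I)‖ ^ 2 /
      ‖(1 : ℂ) + α + y * I‖ ^ 2) := integrable_normSq_smoothCut_div (N := N) hgb hα
  have hP0 : ∀ y : ℝ, 0 ≤ ‖LSeries (mulVM (⇑(cmLift f)) N) (1 + α + y * I)‖ ^ 2 / ‖(1 : ℂ) + α + y * I‖ ^ 2 :=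
    fun y => by positivity
  have hG0 : ∀ y : ℝ, 0 ≤ ‖LSeries (smoothCut (⇑(cmLift f)) N) (1 + α + y * I)‖ ^ 2 / ‖(1 : ℂ) + α + y * I‖ ^ 2 :=
    fun y => by positivity
  set CE : ℝ := 3 * cmDefectBound with hCE
  have hptw : ∀ y ∈ Set.Icc (-T) T, ‖LSeries (mulLog (⇑f) N) (1 + α + y * I)‖ ^ 2 *
        ‖1 - (w : ℂ) ^ (1 - ((1 : ℂ) + α + y * I))‖ ^ 2 / ‖(1 : ℂ) + α + y * I‖ ^ 2 ≤
      2 * Bw ^ 2 * (‖LSeries (mulVM (⇑(cmLift f)) N) (1 + α + y * I)‖ ^ 2 / ‖(1 : ℂ) + α + y * I‖ ^ 2) +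
        8 * CE ^ 2 *
          (‖LSeries (smoothCut (⇑(cmLift f)) N) (1 + α + y * I)‖ ^ 2 / ‖(1 : ℂ) + α + y * I‖ ^ 2) := by
    intro y hy
    have hyT : |y| ≤ T := abs_le.2 ⟨by linarith [hy.1], hy.2⟩
    have hre : 1 < ((1 : ℂ) + α + y * I).re := by rw [Halasz.one_add_re]; linarith
    obtain ⟨-, hE⟩ := norm_LSeries_mulLog_cmDefect_le f hf hfb N hre.le
    set tw : ℂ := 1 - (w : ℂ) ^ (1 - ((1 : ℂ) + α + y * I)) with htw
    have htw2 : ‖tw‖ ≤ 2 := norm_twist_le_two hw hα.le y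
    have hprod : ‖LSeries (mulLog (⇑f) N) (1 + α + y * I)‖ ^ 2 * ‖tw‖ ^ 2 =
        ‖LSeries (mulLog (⇑f) N) (1 + α + y * I) * tw‖ ^ 2 := by rw [norm_mul, mul_pow]
    rw [hprod, LSeries_mulLog_eq_add f hf hfb N hre]
    have hB' := hB y hyT
    have hB0 : 0 ≤ Bw := (norm_nonneg _).trans hB'
    set u := LSeries (mulVM (⇑(cmLift f)) N) (1 + ↑α + ↑y * I) * (LSeries (smoothCut (⇑f) N) (1 + ↑α + ↑y * I) * tw)
    set v := LSeries (smoothCut (⇑(cmLift f)) N) (1 + ↑α + ↑y * I) * LSeries (mulLog (⇑(cmDefect f)) N) (1 + ↑α + ↑y * I) * tw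
    have hsplit : (LSeries (mulVM (⇑(cmLift f)) N) (1 + ↑α + ↑y * I) * LSeries (smoothCut (⇑f) N) (1 + ↑α + ↑y * I) +
        LSeries (smoothCut (⇑(cmLift f)) N) (1 + ↑α + ↑y * I) * LSeries (mulLog (⇑(cmDefect f)) N) (1 + ↑α + ↑y * I)) * tw =
        u + v := by ring
    rw [hsplit]
    have h1 := norm_add_sq_le_eps u v one_pos
    rw [inv_one] at h1
    have hu : ‖u‖ ^ 2 ≤ ‖LSeries (mulVM (⇑(cmLift f)) N) (1 + α + y * I)‖ ^ 2 * Bw ^ 2 := by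
      rw [norm_mul, mul_pow]; gcongr
    have hv : ‖v‖ ^ 2 ≤ ‖LSeries (smoothCut (⇑(cmLift f)) N) (1 + α + y * I)‖ ^ 2 * (CE ^ 2 * 4) := by
      rw [norm_mul, norm_mul, mul_pow, mul_pow, mul_assoc]
      gcongr
      · nlinarith [norm_nonneg tw]
    have hs0 : 0 < ‖(1 : ℂ) + α + y * I‖ ^ 2 := by
      have : ((1 : ℂ) + α + y * I) ≠ 0 := by
        intro h; have := congrArg Complex.re h; simp at this; linarith
      positivity
    calc ‖u + v‖ ^ 2 / ‖(1 : ℂ) + α + y * I‖ ^ 2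
        ≤ ((1 + 1) * (‖LSeries (mulVM (⇑(cmLift f)) N) (1 + α + y * I)‖ ^ 2 * Bw ^ 2) +
            (1 + 1) * (‖LSeries (smoothCut (⇑(cmLift f)) N) (1 + α + y * I)‖ ^ 2 * (CE ^ 2 * 4))) /
            ‖(1 : ℂ) + α + y * I‖ ^ 2 := by
          refine div_le_div_of_nonneg_right ?_ hs0.le
          nlinarith
      _ = 2 * Bw ^ 2 * (‖LSeries (mulVM (⇑(cmLift f)) N) (1 + α + y * I)‖ ^ 2 / ‖(1 : ℂ) + α + y * I‖ ^ 2) +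
            8 * CE ^ 2 *
              (‖LSeries (smoothCut (⇑(cmLift f)) N) (1 + α + y * I)‖ ^ 2 / ‖(1 : ℂ) + α + y * I‖ ^ 2) := by
          field_simp
          ring
  have hB2 : 0 ≤ 2 * Bw ^ 2 := by positivity
  have hC2 : 0 ≤ 8 * CE ^ 2 := by positivity
  calc ∫ y in Set.Icc (-T) T, ‖LSeries (mulLog (⇑f) N) (1 + α + y * I)‖ ^ 2 *
        ‖1 - (w : ℂ) ^ (1 - ((1 : ℂ) + α + y * I))‖ ^ 2 / ‖(1 : ℂ) + α + y * I‖ ^ 2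
      ≤ ∫ y in Set.Icc (-T) T,
          (2 * Bw ^ 2 * (‖LSeries (mulVM (⇑(cmLift f)) N) (1 + α + y * I)‖ ^ 2 / ‖(1 : ℂ) + α + y * I‖ ^ 2) +
            8 * CE ^ 2 *
              (‖LSeries (smoothCut (⇑(cmLift f)) N) (1 + α + y * I)‖ ^ 2 / ‖(1 : ℂ) + α + y * I‖ ^ 2)) :=
        setIntegral_mono_on hintD.integrableOn
          ((hintP.const_mul _).add (hintG.const_mul _)).integrableOn measurableSet_Icc hptw
    _ = 2 * Bw ^ 2 * (∫ y in Set.Icc (-T) T,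
            ‖LSeries (mulVM (⇑(cmLift f)) N) (1 + α + y * I)‖ ^ 2 / ‖(1 : ℂ) + α + y * I‖ ^ 2) +
          8 * CE ^ 2 * (∫ y in Set.Icc (-T) T,
            ‖LSeries (smoothCut (⇑(cmLift f)) N) (1 + α + y * I)‖ ^ 2 / ‖(1 : ℂ) + α + y * I‖ ^ 2) := by
        rw [integral_add (hintP.const_mul _).integrableOn (hintG.const_mul _).integrableOn,
          integral_const_mul, integral_const_mul]
    _ ≤ 2 * Bw ^ 2 * (∫ y : ℝ, ‖LSeries (mulVM (⇑(cmLift f)) N) (1 + α + y * I)‖ ^ 2 /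
            ‖(1 : ℂ) + α + y * I‖ ^ 2) +
          8 * CE ^ 2 * (∫ y : ℝ, ‖LSeries (smoothCut (⇑(cmLift f)) N) (1 + α + y * I)‖ ^ 2 /
            ‖(1 : ℂ) + α + y * I‖ ^ 2) :=
        add_le_add
          (mul_le_mul_of_nonneg_left (setIntegral_le_integral hintP (Filter.Eventually.of_forall hP0)) hB2)
          (mul_le_mul_of_nonneg_left (setIntegral_le_integral hintG (Filter.Eventually.of_forall hG0)) hC2)

/-! ### (3.8) twisted: the inner integral of Proposition 3.3 -/

/-- The real-variable bookkeeping of the twisted (3.8): with `0 ≤ K ≤ m`, `T ≥ 1`,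
`√K · √((1/2π)(2B²(2π·18/α) + 8 C_E² (π/α) + 16Q/T²)) ≤ 6B√(m/α) + C(√(m/α) + √m/√T + m²/T)`,
`Q = (5T/2+20)R₀ + 65 C_R m³`, `C = 2C_E + √(90 R₀) + √(260 C_R) + 1` (for `K < 0`, `√K = 0`). [folklore] -/
theorem final_algebra_twisted {B K CE α m T R₀ CR : ℝ} (hB : 0 ≤ B)
    (hCE : 0 ≤ CE) (hα : 0 < α) (hm : 0 ≤ m) (hKm : K ≤ m) (hT : 1 ≤ T) (hR₀ : 0 ≤ R₀) (hCR : 0 ≤ CR) :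
    Real.sqrt K * Real.sqrt ((1 / (2 * π)) *
        (2 * B ^ 2 * (2 * π * (18 / α)) + 8 * CE ^ 2 * (π / α) +
          16 * ((5 * (T / 2) + 20) * R₀ + 65 * (CR * m ^ 3)) / T ^ 2)) ≤
      6 * B * Real.sqrt (m / α) + (2 * CE + Real.sqrt (90 * R₀) + Real.sqrt (260 * CR) + 1) *
        (Real.sqrt (m / α) + Real.sqrt m / Real.sqrt T + m ^ 2 / T) := by
  have hπ0 : 0 < π := Real.pi_pos
  have hT0 : 0 < T := by linarith
  have sqrt_add_le' : ∀ {a b : ℝ}, 0 ≤ a → 0 ≤ b → Real.sqrt (a + b) ≤ Real.sqrt a + Real.sqrt b := by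
    intro a b ha hb
    rw [Real.sqrt_le_iff]
    refine ⟨by positivity, ?_⟩
    rw [add_sq, Real.sq_sqrt ha, Real.sq_sqrt hb]
    nlinarith [Real.sqrt_nonneg a, Real.sqrt_nonneg b, mul_nonneg (Real.sqrt_nonneg a) (Real.sqrt_nonneg b)]
  set Q : ℝ := (5 * (T / 2) + 20) * R₀ + 65 * (CR * m ^ 3) with hQ
  have hQ0 : 0 ≤ Q := by positivity
  -- simplify the bracket
  have hbr : (1 / (2 * π)) * (2 * B ^ 2 * (2 * π * (18 / α)) + 8 * CE ^ 2 * (π / α) + 16 * Q / T ^ 2) =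
      36 * B ^ 2 / α + 4 * CE ^ 2 / α + (8 / π) * (Q / T ^ 2) := by
    field_simp
    ring
  have h8π : 8 / π ≤ 4 := by
    rw [div_le_iff₀ hπ0]; nlinarith [Real.pi_gt_three]
  have hbr_le : (1 / (2 * π)) * (2 * B ^ 2 * (2 * π * (18 / α)) + 8 * CE ^ 2 * (π / α) + 16 * Q / T ^ 2) ≤
      36 * B ^ 2 / α + 4 * CE ^ 2 / α + 4 * (Q / T ^ 2) := by
    rw [hbr]
    have : 0 ≤ Q / T ^ 2 := by positivity
    nlinarith
  -- `√` of the bracket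
  have hsq : Real.sqrt (36 * B ^ 2 / α + 4 * CE ^ 2 / α + 4 * (Q / T ^ 2)) ≤
      6 * B / Real.sqrt α + 2 * CE / Real.sqrt α + 2 * Real.sqrt Q / T := by
    have hsα : 0 < Real.sqrt α := Real.sqrt_pos.mpr hα
    have e1 : Real.sqrt (36 * B ^ 2 / α) = 6 * B / Real.sqrt α := by
      rw [Real.sqrt_div' _ hα.le, show (36 : ℝ) * B ^ 2 = (6 * B) ^ 2 by ring, Real.sqrt_sq (by positivity)]
    have e2 : Real.sqrt (4 * CE ^ 2 / α) = 2 * CE / Real.sqrt α := by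
      rw [Real.sqrt_div' _ hα.le, show (4 : ℝ) * CE ^ 2 = (2 * CE) ^ 2 by ring, Real.sqrt_sq (by positivity)]
    have e3 : Real.sqrt (4 * (Q / T ^ 2)) = 2 * Real.sqrt Q / T := by
      rw [Real.sqrt_mul (by norm_num), Real.sqrt_div' _ (sq_nonneg T), Real.sqrt_sq hT0.le,
        show (4 : ℝ) = 2 ^ 2 by norm_num, Real.sqrt_sq (by norm_num)]
      ring
    calc Real.sqrt (36 * B ^ 2 / α + 4 * CE ^ 2 / α + 4 * (Q / T ^ 2))
        ≤ Real.sqrt (36 * B ^ 2 / α + 4 * CE ^ 2 / α) + Real.sqrt (4 * (Q / T ^ 2)) :=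
          sqrt_add_le' (by positivity) (by positivity)
      _ ≤ Real.sqrt (36 * B ^ 2 / α) + Real.sqrt (4 * CE ^ 2 / α) + Real.sqrt (4 * (Q / T ^ 2)) := by
          gcongr; exact sqrt_add_le' (by positivity) (by positivity)
      _ = 6 * B / Real.sqrt α + 2 * CE / Real.sqrt α + 2 * Real.sqrt Q / T := by rw [e1, e2, e3]
  have hK0' : 0 ≤ Real.sqrt K := Real.sqrt_nonneg K
  have hKm' : Real.sqrt K ≤ Real.sqrt m := Real.sqrt_le_sqrt hKm
  have hsα : 0 < Real.sqrt α := Real.sqrt_pos.mpr hα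
  -- the three terms
  have hT1 : Real.sqrt K * (6 * B / Real.sqrt α) ≤ 6 * B * Real.sqrt (m / α) := by
    rw [Real.sqrt_div' _ hα.le]
    calc Real.sqrt K * (6 * B / Real.sqrt α) = 6 * B * (Real.sqrt K / Real.sqrt α) := by ring
      _ ≤ 6 * B * (Real.sqrt m / Real.sqrt α) := by gcongr
  have hT2 : Real.sqrt K * (2 * CE / Real.sqrt α) ≤ 2 * CE * Real.sqrt (m / α) := by
    rw [Real.sqrt_div' _ hα.le]
    calc Real.sqrt K * (2 * CE / Real.sqrt α) = 2 * CE * (Real.sqrt K / Real.sqrt α) := by ring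
      _ ≤ 2 * CE * (Real.sqrt m / Real.sqrt α) := by gcongr
  have hT3 : Real.sqrt K * (2 * Real.sqrt Q / T) ≤
      Real.sqrt (90 * R₀) * (Real.sqrt m / Real.sqrt T) + Real.sqrt (260 * CR) * (m ^ 2 / T) := by
    have hQle : Q ≤ 45 / 2 * R₀ * T + 65 * CR * m ^ 3 := by
      have h20 : R₀ * 1 ≤ R₀ * T := mul_le_mul_of_nonneg_left hT hR₀
      rw [hQ]; linarith
    have hsQ : 2 * Real.sqrt Q ≤ Real.sqrt (90 * R₀) * Real.sqrt T + Real.sqrt (260 * CR) * Real.sqrt (m ^ 3) := by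
      have h4Q : 4 * Q ≤ 90 * R₀ * T + 260 * CR * m ^ 3 := by linarith
      calc 2 * Real.sqrt Q = Real.sqrt (4 * Q) := by
            rw [Real.sqrt_mul (by norm_num), show (4 : ℝ) = 2 ^ 2 by norm_num, Real.sqrt_sq (by norm_num)]
        _ ≤ Real.sqrt (90 * R₀ * T + 260 * CR * m ^ 3) := Real.sqrt_le_sqrt h4Q
        _ ≤ Real.sqrt (90 * R₀ * T) + Real.sqrt (260 * CR * m ^ 3) := sqrt_add_le' (by positivity) (by positivity)
        _ = Real.sqrt (90 * R₀) * Real.sqrt T + Real.sqrt (260 * CR) * Real.sqrt (m ^ 3) := by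
            rw [Real.sqrt_mul (show (0:ℝ) ≤ 90 * R₀ by positivity) T,
              Real.sqrt_mul (show (0:ℝ) ≤ 260 * CR by positivity) (m ^ 3)]
    have hmm : Real.sqrt m * Real.sqrt (m ^ 3) = m ^ 2 := by
      rw [← Real.sqrt_mul hm, show m * m ^ 3 = (m ^ 2) ^ 2 by ring, Real.sqrt_sq (sq_nonneg m)]
    have hTT : Real.sqrt T / T = 1 / Real.sqrt T := by
      have hsT : 0 < Real.sqrt T := Real.sqrt_pos.mpr hT0
      rw [div_eq_div_iff hT0.ne' hsT.ne', one_mul, Real.mul_self_sqrt hT0.le]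
    calc Real.sqrt K * (2 * Real.sqrt Q / T) = Real.sqrt K * (2 * Real.sqrt Q) / T := by ring
      _ ≤ Real.sqrt m * (Real.sqrt (90 * R₀) * Real.sqrt T + Real.sqrt (260 * CR) * Real.sqrt (m ^ 3)) / T := by
          gcongr
      _ = Real.sqrt (90 * R₀) * (Real.sqrt m * (Real.sqrt T / T)) +
            Real.sqrt (260 * CR) * ((Real.sqrt m * Real.sqrt (m ^ 3)) / T) := by ring
      _ = Real.sqrt (90 * R₀) * (Real.sqrt m / Real.sqrt T) + Real.sqrt (260 * CR) * (m ^ 2 / T) := by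
          rw [hmm, hTT]; ring
  -- combine
  set C : ℝ := 2 * CE + Real.sqrt (90 * R₀) + Real.sqrt (260 * CR) + 1 with hC
  have hC2 : 2 * CE ≤ C := by rw [hC]; have := Real.sqrt_nonneg (90 * R₀); have := Real.sqrt_nonneg (260 * CR); linarith
  have hC3 : Real.sqrt (90 * R₀) ≤ C := by rw [hC]; have := Real.sqrt_nonneg (260 * CR); linarith
  have hC4 : Real.sqrt (260 * CR) ≤ C := by rw [hC]; have := Real.sqrt_nonneg (90 * R₀); linarith
  have hx1 : 0 ≤ Real.sqrt (m / α) := Real.sqrt_nonneg _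
  have hx2 : 0 ≤ Real.sqrt m / Real.sqrt T := by positivity
  have hx3 : 0 ≤ m ^ 2 / T := by positivity
  have hbr0 : 0 ≤ 36 * B ^ 2 / α + 4 * CE ^ 2 / α + 4 * (Q / T ^ 2) := by positivity
  calc Real.sqrt K * Real.sqrt ((1 / (2 * π)) *
          (2 * B ^ 2 * (2 * π * (18 / α)) + 8 * CE ^ 2 * (π / α) + 16 * Q / T ^ 2))
      ≤ Real.sqrt K * Real.sqrt (36 * B ^ 2 / α + 4 * CE ^ 2 / α + 4 * (Q / T ^ 2)) :=
        mul_le_mul_of_nonneg_left (Real.sqrt_le_sqrt hbr_le) hK0'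
    _ ≤ Real.sqrt K * (6 * B / Real.sqrt α + 2 * CE / Real.sqrt α + 2 * Real.sqrt Q / T) :=
        mul_le_mul_of_nonneg_left hsq hK0'
    _ = Real.sqrt K * (6 * B / Real.sqrt α) + Real.sqrt K * (2 * CE / Real.sqrt α) +
          Real.sqrt K * (2 * Real.sqrt Q / T) := by ring
    _ ≤ 6 * B * Real.sqrt (m / α) + 2 * CE * Real.sqrt (m / α) +
          (Real.sqrt (90 * R₀) * (Real.sqrt m / Real.sqrt T) + Real.sqrt (260 * CR) * (m ^ 2 / T)) :=
        add_le_add (add_le_add hT1 hT2) hT3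
    _ ≤ 6 * B * Real.sqrt (m / α) + C * (Real.sqrt (m / α) + Real.sqrt m / Real.sqrt T + m ^ 2 / T) := by
        have e2 := mul_le_mul_of_nonneg_right hC2 hx1
        have e3 := mul_le_mul_of_nonneg_right hC3 hx2
        have e4 := mul_le_mul_of_nonneg_right hC4 hx3
        nlinarith

/-- The `u`-side of the twisted mean square is dominated: with `a = f̃ log`,
`u ↦ |A(e^u) - wA(e^u/w)|² e^{-2(1+α)u}` is integrable. [folklore] -/
theorem integrable_twisted_meanSquare_integrand (hgb : ∀ n, ‖g n‖ ≤ 1) (N : ℕ) {α : ℝ} (hα : 0 < α)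
    {w : ℝ} (hw : 0 < w) :
    Integrable fun u : ℝ =>
      ‖psum (mulLog g N) (Real.exp u) - (w : ℂ) * psum (mulLog g N) (Real.exp u / w)‖ ^ 2 *
        Real.exp (-(2 * (1 + α) * u)) := by
  have hbd : ∀ y : ℝ, 1 ≤ y → ‖psum (mulLog g N) y‖ ≤ 2 / α * y ^ (1 + α / 2) :=
    fun y hy => Halasz.norm_psum_mulLog_le hgb hα y hy
  have hmem := memLp_two_phi_sub_translate (a := mulLog g N) (σ := 1 + α) hbd (by linarith)
    (((w ^ (1 - (1 + α)) : ℝ) : ℂ)) (Real.log w)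
  have hint := (memLp_two_iff_integrable_sq_norm hmem.1).1 hmem
  refine hint.congr (Filter.Eventually.of_forall fun u => ?_)
  simp only [MellinPlancherel.phi]
  have hexp : Real.exp (u - Real.log w) = Real.exp u / w := by
    rw [Real.exp_sub, Real.exp_log hw]
  have hcw : (((w ^ (1 - (1 + α)) : ℝ) : ℂ)) * (Real.exp (-((1 + α) * (u - Real.log w))) : ℂ) =
      (w : ℂ) * (Real.exp (-((1 + α) * u)) : ℂ) := by
    rw [← Complex.ofReal_mul, ← Complex.ofReal_mul]
    congr 1
    rw [show -((1 + α) * (u - Real.log w)) = -((1 + α) * u) + (1 + α) * Real.log w by ring, Real.exp_add,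
      show (1 + α) * Real.log w = Real.log w * (1 + α) by ring, ← Real.rpow_def_of_pos hw]
    have : w ^ (1 - (1 + α)) * w ^ (1 + α) = w := by
      rw [← Real.rpow_add hw]; norm_num
    calc w ^ (1 - (1 + α)) * (Real.exp (-((1 + α) * u)) * w ^ (1 + α))
        = (w ^ (1 - (1 + α)) * w ^ (1 + α)) * Real.exp (-((1 + α) * u)) := by ring
      _ = w * Real.exp (-((1 + α) * u)) := by rw [this]
  rw [hexp, ← mul_assoc, hcw]
  rw [show (Real.exp (-((1 + α) * u)) : ℂ) * psum (mulLog g N) (Real.exp u) -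
      (w : ℂ) * (Real.exp (-((1 + α) * u)) : ℂ) * psum (mulLog g N) (Real.exp u / w)
      = (Real.exp (-((1 + α) * u)) : ℂ) * (psum (mulLog g N) (Real.exp u) - (w : ℂ) * psum (mulLog g N) (Real.exp u / w)) by ring]
  rw [norm_mul, Complex.norm_real, Real.norm_of_nonneg (Real.exp_pos _).le, mul_pow, ← Real.exp_nat_mul]
  ring_nf

set_option maxHeartbeats 400000 in
/-- **Granville–Soundararajan, Proposition 3.3: the inner integral (twisted (3.8) + Lemma 3.2)**,
crude-constant form.  There is an absolute `C ≥ 0` such that for every multiplicative `f` with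
`|f| ≤ 1`, `x ≥ 3` (`N = ⌊x⌋`), `T ≥ 1`, `0 < α ≤ 1`, `w ≥ 1`, `B_w ≥ 0` with
`|F(s)(1 - w^{1-s})| ≤ B_w` for `s = 1+α+iy`, `|y| ≤ T` (`F = ∑ f̃(n) n^{-s}`), one has, with
`A(y) = ∑_{n ≤ y} f̃(n) log n` and `m = min(log x, 1/α)`,
`∫_{log 2w}^{log x} |A(e^u) - wA(e^u/w)| e^{-(1+2α)u} du ≤ 6 B_w √(m/α) + C (√(m/α) + √m/√T + m²/T)`.
[cite: GranvilleSoundararajan2003, Proposition 3.3 (proof), (3.8)–(3.14)] -/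
theorem exists_inner_integral_twisted_le :
    ∃ C : ℝ, 0 ≤ C ∧ ∀ (f : ArithmeticFunction ℂ), f.IsMultiplicative → (∀ n, ‖f n‖ ≤ 1) →
      ∀ x : ℝ, 3 ≤ x → ∀ T : ℝ, 1 ≤ T → ∀ α : ℝ, 0 < α → α ≤ 1 → ∀ w : ℝ, 1 ≤ w → ∀ Bw : ℝ, 0 ≤ Bw →
        (∀ y : ℝ, |y| ≤ T → ‖LSeries (smoothCut (⇑f) ⌊x⌋₊) (1 + α + y * I) *
          (1 - (w : ℂ) ^ (1 - ((1 : ℂ) + α + y * I)))‖ ≤ Bw) →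
        ∫ u in Set.Ioc (Real.log (2 * w)) (Real.log x),
            ‖psum (mulLog (⇑f) ⌊x⌋₊) (Real.exp u) - (w : ℂ) * psum (mulLog (⇑f) ⌊x⌋₊) (Real.exp u / w)‖ *
              Real.exp (-((1 + 2 * α) * u)) ≤
          6 * Bw * Real.sqrt (min (Real.log x) (1 / α) / α) +
            C * (Real.sqrt (min (Real.log x) (1 / α) / α) +
                  Real.sqrt (min (Real.log x) (1 / α)) / Real.sqrt T +
                  (min (Real.log x) (1 / α)) ^ 2 / T) := by
  obtain ⟨C_W, hCW0, hCW⟩ := exists_tsum_mul_norm_term_mulLog_sq_le_log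
  set R₀ : ℝ := 16 * ∑' n : ℕ, ((n : ℝ) ^ (3 / 2 : ℝ))⁻¹ with hR₀
  have hR₀0 : 0 ≤ R₀ := mul_nonneg (by norm_num) (tsum_nonneg fun n => by positivity)
  set CE : ℝ := 3 * cmDefectBound with hCEdef
  have hCE0 : 0 ≤ CE := by rw [hCEdef]; unfold cmDefectBound; positivity
  set CR : ℝ := max (4 * Real.exp 10) C_W with hCR
  have hCR0 : 0 ≤ CR := le_trans (by positivity) (le_max_left _ _)
  refine ⟨2 * CE + Real.sqrt (90 * R₀) + Real.sqrt (260 * CR) + 1, by positivity, ?_⟩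
  intro f hf hfb x hx T hT α hα hα1 w hw Bw hB0 hB
  set N : ℕ := ⌊x⌋₊ with hN
  set K : ℝ := (1 - x ^ (-(2 * α))) / (2 * α) with hK
  set m : ℝ := min (Real.log x) (1 / α) with hm
  have hx0 : 0 < x := by linarith
  have hx1 : 1 ≤ x := by linarith
  have hT0 : 0 < T := by linarith
  have hw0 : 0 < w := by linarith
  have hlx : 1 ≤ Real.log x := by
    rw [Real.le_log_iff_exp_le hx0]
    exact le_trans (by have := Real.exp_one_lt_d9; linarith) hx
  have hxpow : x ^ (-(2 * α)) < 1 := Real.rpow_lt_one_of_one_lt_of_neg (by linarith) (by linarith)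
  have hxpow0 : 0 < x ^ (-(2 * α)) := Real.rpow_pos_of_pos hx0 _
  have hm0 : 0 ≤ m := le_min (by linarith) (by positivity)
  have hKm : K ≤ m := by
    refine le_min ?_ ?_
    · rw [hK, div_le_iff₀ (by positivity)]
      have h := Real.add_one_le_exp (Real.log x * (-(2 * α)))
      rw [← Real.rpow_def_of_pos hx0] at h
      nlinarith
    · rw [hK, div_le_div_iff₀ (by positivity) hα]; nlinarith
  have hgb : ∀ n, ‖cmLift f n‖ ≤ 1 := norm_cmLift_le_one f (fun p _ => hfb p)
  -- coefficient data for the tails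
  obtain ⟨hs₀, hR₀le⟩ := tsum_norm_term_mulLog_sq_le (g := ⇑f) (N := N) hfb hα
  obtain ⟨hs₁, hR₁a⟩ := Halasz.tsum_mul_norm_term_mulLog_sq_le (g := ⇑f) (N := N) hfb hα hα1
  have hR₁b := hCW (⇑f) hfb x hx α hα
  have hR₁ : ∑' n : ℕ, (n : ℝ) * ‖LSeries.term (mulLog (⇑f) N) (1 + α) n‖ ^ 2 ≤ CR * m ^ 3 := by
    rcases le_total (Real.log x) (1 / α) with h | h
    · rw [hm, min_eq_left h]
      exact hR₁b.trans (mul_le_mul_of_nonneg_right (le_max_right _ _) (by positivity))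
    · rw [hm, min_eq_right h]
      calc _ ≤ 4 * Real.exp 10 / α ^ 3 := hR₁a
        _ = 4 * Real.exp 10 * (1 / α) ^ 3 := by field_simp
        _ ≤ CR * (1 / α) ^ 3 := mul_le_mul_of_nonneg_right (le_max_left _ _) (by positivity)
  set Q : ℝ := (5 * (T / 2) + 20) * R₀ + 65 * (CR * m ^ 3) with hQ
  have hQ0 : 0 ≤ Q := by positivity
  have htails := twisted_tails_le (N := N) hfb hα hT0 hw hR₀le hs₁ hR₁
  -- the window
  have hIP : ∫ y : ℝ, ‖LSeries (mulVM (⇑(cmLift f)) N) (1 + α + y * I)‖ ^ 2 / ‖(1 : ℂ) + α + y * I‖ ^ 2 ≤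
      2 * π * (18 / α) := by
    have h1 := Halasz.meanSquare_mulVM_eq (g := ⇑(cmLift f)) (N := N) hgb hα
    have h2 := Halasz.meanSquare_mulVM_le (g := ⇑(cmLift f)) (N := N) hgb hα
    rw [h1] at h2
    have hπ : 0 < 2 * π := by positivity
    calc ∫ y : ℝ, ‖LSeries (mulVM (⇑(cmLift f)) N) (1 + α + y * I)‖ ^ 2 / ‖(1 : ℂ) + α + y * I‖ ^ 2
        = 2 * π * (1 / (2 * π) * ∫ y : ℝ, ‖LSeries (mulVM (⇑(cmLift f)) N) (1 + α + y * I)‖ ^ 2 /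
            ‖(1 : ℂ) + α + y * I‖ ^ 2) := by rw [← mul_assoc, mul_one_div_cancel hπ.ne', one_mul]
      _ ≤ 2 * π * (18 / α) := by gcongr
  have hIG := integral_normSq_smoothCut_div_le (N := N) hgb hα
  have hwin := setIntegral_window_twisted_le f hf hfb N hα (T := T) hw hB
  -- the whole line
  have hJ : ∫ y : ℝ, ‖LSeries (mulLog (⇑f) N) (1 + α + y * I)‖ ^ 2 *
        ‖1 - (w : ℂ) ^ (1 - ((1 : ℂ) + α + y * I))‖ ^ 2 / ‖(1 : ℂ) + α + y * I‖ ^ 2 ≤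
      2 * Bw ^ 2 * (2 * π * (18 / α)) + 8 * CE ^ 2 * (π / α) + 16 * Q / T ^ 2 := by
    have h := twisted_integral_le_window_add_tails (g := ⇑f) (N := N) hfb hα hT0.le hw
    have e1 : 2 * Bw ^ 2 * (∫ y : ℝ, ‖LSeries (mulVM (⇑(cmLift f)) N) (1 + α + y * I)‖ ^ 2 /
        ‖(1 : ℂ) + α + y * I‖ ^ 2) ≤ 2 * Bw ^ 2 * (2 * π * (18 / α)) :=
      mul_le_mul_of_nonneg_left hIP (by positivity)
    have e2 : 8 * (3 * cmDefectBound) ^ 2 *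
        (∫ y : ℝ, ‖LSeries (smoothCut (⇑(cmLift f)) N) (1 + α + y * I)‖ ^ 2 / ‖(1 : ℂ) + α + y * I‖ ^ 2) ≤
        8 * CE ^ 2 * (π / α) := by
      rw [hCEdef]
      exact mul_le_mul_of_nonneg_left hIG (by positivity)
    have : 16 * ((5 * (T / 2) + 20) * R₀ + 65 * (CR * m ^ 3)) / T ^ 2 = 16 * Q / T ^ 2 := by rw [hQ]
    rw [this] at htails
    linarith
  -- the `u`-side mean square
  have hbd : ∀ y : ℝ, 1 ≤ y → ‖psum (mulLog (⇑f) N) y‖ ≤ 2 / α * y ^ (1 + α / 2) :=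
    fun y hy => Halasz.norm_psum_mulLog_le hfb hα y hy
  have hJu : ∫ u : ℝ, ‖psum (mulLog (⇑f) N) (Real.exp u) - (w : ℂ) * psum (mulLog (⇑f) N) (Real.exp u / w)‖ ^ 2 *
        Real.exp (-(2 * (1 + α) * u)) ≤
      (1 / (2 * π)) * (2 * Bw ^ 2 * (2 * π * (18 / α)) + 8 * CE ^ 2 * (π / α) + 16 * Q / T ^ 2) := by
    have hP := integral_norm_sq_psum_sub_exp (a := mulLog (⇑f) N) (σ := 1 + α) (θ := 1 + α / 2) (C := 2 / α)
      (by linarith) (Halasz.summable_norm_mulLog_div_rpow hfb (by linarith)) (by linarith) hbd hw0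
    simp only [Halasz.ofReal_one_add] at hP
    rw [hP]
    exact mul_le_mul_of_nonneg_left hJ (by positivity)
  set Jb : ℝ := (1 / (2 * π)) * (2 * Bw ^ 2 * (2 * π * (18 / α)) + 8 * CE ^ 2 * (π / α) + 16 * Q / T ^ 2) with hJb
  have hJb0 : 0 ≤ Jb := by positivity
  -- Cauchy–Schwarz in `u`
  set μ : Measure ℝ := volume.restrict (Set.Ioc (Real.log (2 * w)) (Real.log x)) with hμ
  set fu : ℝ → ℝ := fun u => ‖psum (mulLog (⇑f) N) (Real.exp u) - (w : ℂ) * psum (mulLog (⇑f) N) (Real.exp u / w)‖ *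
    Real.exp (-((1 + α) * u)) with hfu
  set hh : ℝ → ℝ := fun u => Real.exp (-(α * u)) with hhh
  have hfh : ∀ u, ‖psum (mulLog (⇑f) N) (Real.exp u) - (w : ℂ) * psum (mulLog (⇑f) N) (Real.exp u / w)‖ *
      Real.exp (-((1 + 2 * α) * u)) = fu u * hh u := by
    intro u
    simp only [hfu, hhh]
    rw [mul_assoc, ← Real.exp_add]
    congr 2
    ring
  simp_rw [hfh]
  have hfmeas : AEStronglyMeasurable fu μ := by
    refine (Measurable.aestronglyMeasurable ?_)
    refine Measurable.mul ?_ (Real.measurable_exp.comp (by fun_prop))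
    refine Measurable.norm ?_
    refine Measurable.sub ((MellinPlancherel.measurable_psum _).comp Real.measurable_exp) ?_
    exact ((MellinPlancherel.measurable_psum _).comp (Real.measurable_exp.div_const w)).const_mul _
  have hhmeas : AEStronglyMeasurable hh μ := (by fun_prop : Continuous hh).aestronglyMeasurable
  have hlog2w : 0 < Real.log (2 * w) := Real.log_pos (by linarith)
  have hfbd : ∀ᵐ u ∂μ, ‖fu u‖ ≤ 2 * (x * Real.log x) := by
    refine ae_restrict_of_forall_mem measurableSet_Ioc fun u hu => ?_
    simp only [hfu, Real.norm_eq_abs]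
    rw [abs_of_nonneg (by positivity)]
    exact norm_twisted_kernel_le hfb N hx1 hw (by linarith) hu
  have hhbd : ∀ᵐ u ∂μ, ‖hh u‖ ≤ 1 := by
    refine ae_restrict_of_forall_mem measurableSet_Ioc fun u hu => ?_
    simp only [hhh, Real.norm_eq_abs, abs_of_pos (Real.exp_pos _), Real.exp_le_one_iff]
    have : 0 < u := hlog2w.trans hu.1
    nlinarith
  have hfmem : MemLp fu (ENNReal.ofReal 2) μ := by
    rw [ENNReal.ofReal_ofNat]; exact MemLp.of_bound hfmeas _ hfbd
  have hhmem : MemLp hh (ENNReal.ofReal 2) μ := by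
    rw [ENNReal.ofReal_ofNat]; exact MemLp.of_bound hhmeas _ hhbd
  have hH := integral_mul_le_Lp_mul_Lq_of_nonneg Real.HolderConjugate.two_two
    (Filter.Eventually.of_forall fun u => by positivity)
    (Filter.Eventually.of_forall fun u => (Real.exp_pos _).le) hfmem hhmem
  have hf2 : ∫ u, fu u ^ (2:ℝ) ∂μ ≤ Jb := by
    simp_rw [Real.rpow_two]
    have hint := integrable_twisted_meanSquare_integrand (g := ⇑f) hfb N hα hw0
    have heq : ∀ u, fu u ^ 2 = ‖psum (mulLog (⇑f) N) (Real.exp u) - (w : ℂ) * psum (mulLog (⇑f) N) (Real.exp u / w)‖ ^ 2 *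
        Real.exp (-(2 * (1 + α) * u)) := by
      intro u
      simp only [hfu]
      rw [mul_pow, ← Real.exp_nat_mul]
      congr 2
      push_cast
      ring
    simp_rw [heq]
    exact (setIntegral_le_integral hint (Filter.Eventually.of_forall fun u => by positivity)).trans hJu
  have hh2 : ∫ u, hh u ^ (2:ℝ) ∂μ ≤ K := by
    simp_rw [Real.rpow_two]
    have heq : ∀ u, hh u ^ 2 = Real.exp (-(2 * α) * u) := by
      intro u
      simp only [hhh]
      rw [← Real.exp_nat_mul]
      congr 1
      push_cast
      ring
    simp_rw [heq]
    have hsub : Set.Ioc (Real.log (2 * w)) (Real.log x) ⊆ Set.Ioc (Real.log 2) (Real.log x) := by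
      intro u hu
      have : Real.log 2 ≤ Real.log (2 * w) := Real.log_le_log (by norm_num) (by linarith)
      exact ⟨this.trans_lt hu.1, hu.2⟩
    have hIoi : IntegrableOn (fun u => Real.exp (-(2 * α) * u)) (Set.Ioc (Real.log 2) (Real.log x)) :=
      (integrableOn_exp_mul_Ioi (by linarith : -(2 * α) < 0) _).mono_set Set.Ioc_subset_Ioi_self
    calc ∫ u in Set.Ioc (Real.log (2 * w)) (Real.log x), Real.exp (-(2 * α) * u)
        ≤ ∫ u in Set.Ioc (Real.log 2) (Real.log x), Real.exp (-(2 * α) * u) :=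
          setIntegral_mono_set hIoi (Filter.Eventually.of_forall fun u => (Real.exp_pos _).le) hsub.eventuallyLE
      _ ≤ K := setIntegral_exp_neg_le_K hx hα
  have hf2_0 : 0 ≤ ∫ u, fu u ^ (2:ℝ) ∂μ := integral_nonneg fun u => by positivity
  have hh2_0 : 0 ≤ ∫ u, hh u ^ (2:ℝ) ∂μ := integral_nonneg fun u => by positivity
  have halg := final_algebra_twisted (B := Bw) (CE := CE) (R₀ := R₀) (CR := CR) hB0 hCE0 hα hm0 hKm hT hR₀0 hCR0
  calc ∫ u, fu u * hh u ∂μ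
      ≤ (∫ u, fu u ^ (2:ℝ) ∂μ) ^ (1 / (2:ℝ)) * (∫ u, hh u ^ (2:ℝ) ∂μ) ^ (1 / (2:ℝ)) := hH
    _ ≤ Jb ^ (1 / (2:ℝ)) * K ^ (1 / (2:ℝ)) :=
        mul_le_mul (Real.rpow_le_rpow hf2_0 hf2 (by norm_num)) (Real.rpow_le_rpow hh2_0 hh2 (by norm_num))
          (Real.rpow_nonneg hh2_0 _) (Real.rpow_nonneg hJb0 _)
    _ = Real.sqrt K * Real.sqrt Jb := by
        rw [Real.sqrt_eq_rpow, Real.sqrt_eq_rpow, mul_comm]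
    _ ≤ 6 * Bw * Real.sqrt (m / α) + (2 * CE + Real.sqrt (90 * R₀) + Real.sqrt (260 * CR) + 1) *
          (Real.sqrt (m / α) + Real.sqrt m / Real.sqrt T + m ^ 2 / T) := by
        rw [hJb, hQ]
        exact halg


end GranvilleSoundararajan

end Literature.NumberTheory.LFunctions
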